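import Summits.ResolutionOfSingularities.ResolutionOfSingularities.Theorems.FrobeniusLadderFRationalResolutionFixedChartOfSummand
import HarnessLib

/-!
# Crux `FrobeniusLadder.FRationalResolution` (stmt-ResolutionOfSingularities-15317), line `redirect`,
# stub `stub_diagonalizableQuotientResolution` — item (F2c): the split-off step (S₀) as a PARTIAL re-charting: for ANY subgroup
# `C` with `B + C = A` the sub-chart `(C, S_t^{(C)})` has the same shape and invariants and its unit-degree subgroup is `B ∩ C`

`…FixedChartOfSummand.exists_fixed_chart_of_isCompl` is the case `B ⊓ C = ⊥` (then `B ∩ C = 0`: a FIXED point). The induction of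
MEMO-15317-leafhand2-g22 (root adjunction makes a cyclic subgroup `U = ⟨a⟩ ≤ B̃` of maximal order appear; splitting off a
complement `C` of `U` lowers `|B̃ ∩ C| = |B̃| / |U|`) needs the general statement:

* ★★ `exists_subchart_of_sup_eq_top` — chart `(A, S, 𝒮, φ)` of the stub's shape, point `v`, prime `𝔔` over `v` with unit-degree
  subgroup `B`, and a subgroup `C ≤ A` with `B ⊔ C = ⊤` ⇒ a chart of the same shape graded by (a copy `K = C` of) `C`, namely
  `(C, (S_t)^{(C)})` (regular: `S_t` is free over it on homogeneous units — Stacks 07NG; finite type; degree-zero part `(S₀)_t`,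
  étale over `X`), a point `v'` with `φ' v' = φ v`, a prime `𝔔'` over `v'`, and unit-degree subgroup `{c ∈ C : c ∈ B}`.

Honest label: helper toward ONE leaf stub; no stub, crux or summit closed. No definitions, no named facts, no sorry.
[folklore; cite: SGA3, Exp. VIII §4–5] [cite: StacksProject, Tag 07NG]
-/

noncomputable section

-- single-problem summit: the doubled namespace component is forced
set_option linter.dupNamespace false

open CategoryTheory AlgebraicGeometry
open Literature.RingTheory.GradedAlgebra
open Literature.AlgebraicGeometry.Resolution
open Literature.AlgebraicGeometry.Resolution.DiagonalizableQuotient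

namespace Summit.ResolutionOfSingularities.ResolutionOfSingularities.Theorems.FRationalResolution.SubchartOfSummand

/-- ★★ **(S₀) The sub-chart along a supplement of the unit degrees.** Chart `(A, S, 𝒮, φ)` of the stub's shape (`S` regular
of finite type over the field `k`, graded by the finite abelian group `A`, `φ : Spec S₀ → X` étale and compatible with the
structure maps), `v` a point, `𝔔` a prime over `v` with unit-degree subgroup `B`, and `C ≤ A` with `B ⊔ C = ⊤`. Then there are a
subgroup `K = C`, a chart `(K, S', 𝒮', φ')` of the same shape, a point `v'` with `φ' v' = φ v` and a prime `𝔔'` of `S'` over `v'`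
whose unit-degree subgroup is `{c ∈ K : c ∈ B}`. [folklore; cite: SGA3, Exp. VIII §4–5] [cite: StacksProject, Tag 07NG] -/
theorem exists_subchart_of_sup_eq_top (k : Type) [Field k] (X : Scheme.{0}) (g : X ⟶ Spec (.of k))
    (A : Type) [AddCommGroup A] [Finite A] [DecidableEq A] (S : Type) [CommRing S] [Algebra k S]
    (𝒮 : A → Submodule k S) [GradedAlgebra 𝒮] [Algebra.FiniteType k S] [IsRegularRing S]
    (φ : Spec (.of (𝒮 0)) ⟶ X) [Etale φ]
    (hφg : φ ≫ g = Spec.map (CommRingCat.ofHom (algebraMap k (𝒮 0))))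
    (v : Spec (.of (𝒮 0))) (𝔔 : Ideal S) [𝔔.IsPrime] (h𝔔v : 𝔔.comap (algebraMap (𝒮 0) S) = v.asIdeal)
    (B C : AddSubgroup A) (hB : ∀ a : A, a ∈ B ↔ ∃ s ∈ 𝒮 a, s ∉ 𝔔) (hsup : B ⊔ C = ⊤) :
    ∃ (K : AddSubgroup A) (_ : DecidableEq K), K = C ∧
      ∃ (S' : Type) (_ : CommRing S') (_ : Algebra k S') (𝒮' : K → Submodule k S') (_ : GradedAlgebra 𝒮'),
      Algebra.FiniteType k S' ∧ IsRegularRing S' ∧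
      ∃ (φ' : Spec (.of (𝒮' 0)) ⟶ X), Etale φ' ∧
        φ' ≫ g = Spec.map (CommRingCat.ofHom (algebraMap k (𝒮' 0))) ∧
        ∃ (v' : Spec (.of (𝒮' 0))) (𝔔' : Ideal S') (_ : 𝔔'.IsPrime),
          𝔔'.comap (algebraMap (𝒮' 0) S') = v'.asIdeal ∧
          (∀ c : K, (∃ s ∈ 𝒮' c, s ∉ 𝔔') ↔ (c : A) ∈ B) ∧ φ' v' = φ v := by
  classical
  have hA : AddMonoid.IsTorsion A := fun a => isOfFinAddOrder_of_finite a
  -- localize away from one degree-zero element: global homogeneous units in the degrees of `B`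
  obtain ⟨t, ht0, _, hT, hloc⟩ := AwayUnits.exists_away_units (k := k) 𝒮 𝔔 B hB
  let L : Type := Localization.Away t
  obtain ⟨hprime, hcomap, hBL, -, hunitL⟩ := hloc L
  let ℒ : A → Submodule k L := locPiece 𝒮 (Submonoid.powers t) hT L
  letI instℒ : GradedAlgebra ℒ := (nonempty_gradedAlgebra_locPiece 𝒮 _ hT L).some
  set 𝔔L : Ideal L := 𝔔.map (algebraMap S L) with h𝔔L
  haveI : 𝔔L.IsPrime := hprime
  haveI : Nontrivial L := FixedChartOfSummand.nontrivial_of_ne_top 𝔔L hprime.ne_top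
  haveI : Algebra.FiniteType k L := by
    show Algebra.FiniteType k (Localization (Submonoid.powers t))
    infer_instance
  haveI : IsRegularRing L := isRegularRing_localization (Submonoid.powers t)
  -- coarsen along `A → A/C`; the sub-chart ring `L^{(C)} = ℒ' 0` graded by `C = ker`
  let f : A →+ A ⧸ C := QuotientAddGroup.mk' C
  have hker : f.ker = C := QuotientAddGroup.ker_mk' C
  obtain ⟨ℒ', instℒ', hℒ', -⟩ := Coarsening.exists_coarsening ℒ f
  obtain ⟨𝒯, inst𝒯, h𝒯⟩ := SummandChart.exists_kernelGrading ℒ f ℒ' hℒ'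
  have hA' : AddMonoid.IsTorsion (A ⧸ C) := fun c => by
    obtain ⟨a, rfl⟩ := QuotientAddGroup.mk_surjective c
    exact f.isOfFinAddOrder (hA a)
  -- units in every class of `A/C`, regularity and finiteness of `L^{(C)}`
  have hsup' : B ⊔ f.ker = ⊤ := by rw [hker]; exact hsup
  have hunits : ∀ c : A ⧸ C, ∃ u ∈ ℒ' c, IsUnit u :=
    SummandChart.exists_unit_coarse_of_sup_eq_top ℒ f ℒ' hℒ' B hunitL hsup'
      (QuotientAddGroup.mk'_surjective C)
  have hreg : IsRegularRing (ℒ' 0) := SummandChart.isRegularRing_gradeZero_of_units ℒ' hA' hunits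
  have hft : Algebra.FiniteType k (ℒ' 0) := SummandChart.finiteType_gradeZero ℒ f ℒ' hℒ' hA'
  -- the degree-zero parts: `S₀ → (S_t)_0 ≅ (L^{(C)})_0`
  obtain ⟨e, he⟩ := SummandChart.exists_ringEquiv_gradeZero ℒ f ℒ' hℒ' 𝒯 h𝒯
  let j : 𝒮 0 →+* ℒ 0 := locPieceZeroHom 𝒮 (Submonoid.powers t) hT L
  have hjval : ∀ a, (j a : L) = algebraMap S L a := fun a => rfl
  have hjet : j.Etale := FixedChart.etale_locPieceZeroHom 𝒮 ht0 hT L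
  have hejval : ∀ a, ((e (j a) : ℒ' 0) : L) = algebraMap S L a := fun a => by rw [he, hjval]
  haveI : Etale (Spec.map (CommRingCat.ofHom j)) := (HasRingHomProperty.Spec_iff (P := @Etale)).mpr hjet
  haveI : IsIso (CommRingCat.ofHom (R := ℒ 0) (S := 𝒯 0) e.toRingHom) := by
    show IsIso (RingEquiv.toCommRingCatIso (R := ℒ 0) (S := 𝒯 0) e).hom
    infer_instance
  let φ' : Spec (.of (𝒯 0)) ⟶ X :=
    Spec.map (CommRingCat.ofHom (R := ℒ 0) (S := 𝒯 0) e.toRingHom) ≫ Spec.map (CommRingCat.ofHom j) ≫ φ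
  haveI hφ'et : Etale φ' := inferInstance
  have hφ'g : φ' ≫ g = Spec.map (CommRingCat.ofHom (R := k) (S := 𝒯 0) (algebraMap k (𝒯 0))) := by
    simp only [φ', Category.assoc, hφg, ← Spec.map_comp]
    congr 1
    refine CommRingCat.hom_ext (RingHom.ext fun c => ?_)
    apply Subtype.ext
    apply Subtype.ext
    simp only [CommRingCat.hom_comp, CommRingCat.hom_ofHom, RingHom.coe_comp, Function.comp_apply]
    show ((e (j (algebraMap k (𝒮 0) c)) : ℒ' 0) : L) = ((algebraMap k (𝒯 0) c : ℒ' 0) : L)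
    rw [hejval, SetLike.GradeZero.coe_algebraMap, SetLike.GradeZero.coe_algebraMap,
      SetLike.GradeZero.coe_algebraMap, ← IsScalarTower.algebraMap_apply]
  -- the prime of `L^{(C)}`, its point, and its unit degrees
  let 𝔔T : Ideal (ℒ' 0) := 𝔔L.comap (algebraMap (ℒ' 0) L)
  haveI h𝔔T : 𝔔T.IsPrime := Ideal.IsPrime.comap _
  let v' : Spec (.of (𝒯 0)) := ⟨𝔔T.comap (algebraMap (𝒯 0) (ℒ' 0)), Ideal.IsPrime.comap _⟩
  have hunitsT : ∀ c : f.ker, (∃ s ∈ 𝒯 c, s ∉ 𝔔T) ↔ (c : A) ∈ B := by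
    intro c
    rw [hBL (c : A)]
    constructor
    · rintro ⟨s, hs, hsQ⟩
      exact ⟨(s : L), (h𝒯 c s).1 hs, fun h => hsQ (Ideal.mem_comap.2 h)⟩
    · rintro ⟨x, hx, hxQ⟩
      have hx0 : x ∈ ℒ' 0 := CoarseningEtale.le_coarse_zero ℒ f ℒ' hℒ' c.2 hx
      exact ⟨⟨x, hx0⟩, (h𝒯 c _).2 hx, fun h => hxQ (Ideal.mem_comap.1 h)⟩
  have hv' : Spec.map (CommRingCat.ofHom j) (Spec.map (CommRingCat.ofHom (R := ℒ 0) (S := 𝒯 0) e.toRingHom) v') = v := by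
    apply PrimeSpectrum.ext
    rw [Spec.map_apply, PrimeSpectrum.comap_asIdeal, Spec.map_apply, PrimeSpectrum.comap_asIdeal]
    show ((𝔔T.comap (algebraMap (𝒯 0) (ℒ' 0))).comap e.toRingHom).comap j = v.asIdeal
    rw [Ideal.comap_comap, Ideal.comap_comap, Ideal.comap_comap, ← h𝔔v, ← hcomap, Ideal.comap_comap]
    congr 1
    ext a
    exact hejval a
  have hφ'v : φ' v' = φ v := by
    show φ (Spec.map (CommRingCat.ofHom j) (Spec.map (CommRingCat.ofHom (R := ℒ 0) (S := 𝒯 0) e.toRingHom) v')) = φ v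
    rw [hv']
  exact ⟨f.ker, inferInstance, hker, ℒ' 0, inferInstance, inferInstance, 𝒯, inst𝒯, hft, hreg, φ', hφ'et, hφ'g, v', 𝔔T,
    h𝔔T, rfl, hunitsT, hφ'v⟩

end Summit.ResolutionOfSingularities.ResolutionOfSingularities.Theorems.FRationalResolution.SubchartOfSummand

end
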